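/-
Copyright (c) 2026 the pub-hodgecm-mathlib formalisation cell (harness21).  Prover seat hodgecm-mathlib-K2E3-p05 (g0), Track B «K2-LIT»,
engine E3 «EllipticInputs», unit U4 «Keys», 2026-09-03.  KERNEL module: THEOREMS ONLY (no definition, no named fact, no `sorry`,
no instance, no notation).
-/
import Summits.HodgeConjecture.HodgeConjecture.Theorems.F0P3ReducibleOfIntertwiningCompositionZero  -- ★ the K1w apparatus: Frobenius existence form, ★ N1 Jacquet filtrations, strict monotonicity of `r`, N6
import HarnessLib

/-!
# K2 ∕ E3 «EllipticInputs», unit U4 «Keys» — «WE MAY ASSUME `Re s > 0`», part 1: reducibility of `i_G(χ)` passes to the Weyl conjugate `i_G(wχ)`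
# (`χ` regular) [Keys1984 §7 p. 126 «We may assume Re λ > 0»; BernsteinZelevinsky1977 Thm. 2.9; Casselman1995 §6.4]

Cell hodgecm-mathlib (D-0151), FLOOR 0, Track B «K2-LIT», engine E3, crux item H413 = stmt-HodgeConjecture-24833 (route `HCCMUnconditional`, no route verbs);
SIGS-TABLE-K2E3 row #5 (U4-b) residue [Keys1984 §7 Thm (2)] (★ `K2E3CompZeroKeysListRegularOfKeysThmTwo`, p854986): the first step of Keys' proof of Theorem (2)
is the reduction to `Re s > 0` by the Weyl reflection `λ_s ↦ w(λ_s) = λ̄⁻¹_{-s}`, which needs «`Ind λ_s` reducible ⇔ `Ind w(λ_s)` reducible».  This file proves the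
direction-free half of that in house.  Author K2E3-p05 (g0).  `--supports stmt-HodgeConjecture-24833 --as helper`; THEOREMS ONLY.

THE MATHEMATICS.  `G = U(Φ₃)(L⁺_v)`, `v` non-split, `χ = (χ₁, χ₂)` continuous and REGULAR (`χ ≠ wχ = (χ̄₁⁻¹, χ₂)`).  Suppose `i_G(χ)` has a `G`-stable `⊥ ≠ N ≠ ⊤`
but `i_G(wχ)` has none.  The Jacquet module `r(i_G(wχ))` has a `χ`-LINE with quotient `wχ` (★ N1 at `wχ`, `w² = 1`), so (★ eigen-line functional + ★ Frobenius)
there is a non-zero `B : i_G(wχ) → i_G(χ)`; it is injective (`ker B` is `G`-stable, `≠ ⊤`).  If `range B < ⊤`, ★ strict monotonicity of `r` along chains of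
`G`-subspaces of `i_G(χ)` (every constituent of `i_G(χ)` has `r ≠ 0`, ★ N6) gives `dim r(range B) < dim r(i_G(χ)) = 2`, while `range B ≅ i_G(wχ)` has `dim r = 2` —
absurd; so `B` is bijective and `N ↦ B⁻¹N` produces a `G`-stable `⊥ ≠ B⁻¹N ≠ ⊤` in `i_G(wχ)` — absurd.  Hence **`i_G(χ)` reducible ⇒ `i_G(wχ)` reducible** (and
conversely by `w² = 1`).  [BernsteinZelevinsky1977, Thm. 2.9: `i(χ) ≅ i(wχ)` when irreducible; Casselman1995 §6.4.]
* §1 `weyl_reducible_of_reducible` — ABSTRACT form over the interface of ★ `F0P3ReducibleOfIntertwiningCompositionZero.reducible_of_forall_comp_eq_zero`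
  (parabolic triple with commutative Levi and `N` a limit of compact opens; `I`, `I'` for `i(χ)`, `i(χ')`, `χ ≠ χ'`; Frobenius in existence form; the Jacquet data).
* §2 `cmPrincipalSeries_weylConj_reducible_of_reducible` — the CM instance, all inputs ★ and hypothesis-free; §2′ `…_of_weylConj_reducible` — the converse (`w² = 1`).
HONEST LABEL: HC_CM is proved only modulo the 7 printed citations (2 remaining named inputs: hLiu418 = stmt-HodgeConjecture-24832, h413 = stmt-HodgeConjecture-24833)
until rung 0 closes; count-neutral (a classical lemma made available in house; no printed citation is discharged).

## References
* [Keys1984] D. Keys, Compositio Math. 51 (1984), §7 p. 126 («We may assume `Re λ > 0`»), §3 (the operators `A(w, λ)`).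
* [BernsteinZelevinsky1977] I. N. Bernstein, A. V. Zelevinsky, Ann. Sci. ÉNS 10 (1977), §2.3, Thm. 2.9.
* [Casselman1995] W. Casselman, *Introduction to the theory of admissible representations of p-adic reductive groups* (draft 1995), Prop. 6.4.1, §6.4, Prop. 3.2.3.
* [Rogawski1990] J. D. Rogawski, Ann. of Math. Stud. 123 (1990), §12.2 p. 173 («`i_G(χ)` and `i_G(wχ)` have the same sets of constituents»).
-/

set_option autoImplicit false
-- the mandated namespace has the single-problem summit's repeated segment (`HodgeConjecture.HodgeConjecture`)
set_option linter.dupNamespace false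

noncomputable section

open NumberField IsDedekindDomain MeasureTheory
open scoped Matrix

open Literature.NumberTheory Literature.NumberTheory.Automorphic Literature.NumberTheory.Automorphic.UnitaryGroup
open Literature.NumberTheory.Rogawski1990
open Literature.RepresentationTheory.FiniteGroups Literature.RepresentationTheory.Semisimple

namespace Summit.HodgeConjecture.HodgeConjecture.Cruxes.H413.K2E3PrincipalSeriesWeylReducible

open F0P2pTorusPairsAndVacuity F0P2pCmPrincipalSeriesInterface F0P2pEigenlineFunctionals

universe u

/-! ## §1 Abstract: reducibility passes from `I ≅ i(χ)` to `I' ≅ i(χ')` -/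

section Abstract

variable {G : Type u} [Group G] [TopologicalSpace G] [IsTopologicalGroup G] (t : ParabolicTriple G) [LocallyCompactSpace t.P]

/-- **Reducibility passes to the Weyl conjugate, abstract form.**  `t = (P, M, N)` with commutative Levi `M` and `N` a limit of compact open subgroups; `χ ≠ χ'`
characters of `M`; `I` (smooth, every constituent with non-zero Jacquet module, `r I` two-dimensional) and `I'` (`r I'` two-dimensional with a `χ`-line and
quotient `χ'`) stand for `i(χ)`, `i(χ')`; Frobenius in existence form turns a non-zero `M`-map `r I' → χ` into a non-zero `G`-map `I' → I`.  If `I` has a `G`-stable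
`⊥ ≠ N ≠ ⊤` then so does `I'`.  (A non-zero `B : I' → I` exists; were `I'` irreducible, `B` would be injective; `range B < ⊤` contradicts ★ strict monotonicity of `r`
(`range B ≅ I'` has `dim r = 2 = dim r I`), and `range B = ⊤` makes `B` an isomorphism carrying `N` back to `I'`.)
[cite: BernsteinZelevinsky1977, Thm. 2.9] [cite: Casselman1995, §6.4, Prop. 6.4.1 p. 62, Prop. 3.2.3 p. 34] -/
theorem weyl_reducible_of_reducible (hN : IsLimitOfCompactOpen t.N) (hcomm : ∀ m m' : ↥t.M, m * m' = m' * m)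
    (χ χ' : ↥t.M →* ℂˣ) (hne : χ ≠ χ')
    {V V' : Type} [AddCommGroup V] [Module ℂ V] [AddCommGroup V'] [Module ℂ V']
    (I : Representation ℂ G V) (I' : Representation ℂ G V') (hsm : I.IsSmooth)
    (hFrob : ∀ φ : (I'.normalizedJacquet t).IntertwiningMap ((Representation.trivial ℂ ↥t.M ℂ).twist χ), φ ≠ 0 →
      ∃ B : I'.IntertwiningMap I, B ≠ 0)
    (hJ : FiniteDimensional ℂ (t.restrict I).Coinvariants ∧ Module.finrank ℂ (t.restrict I).Coinvariants = 2)
    (hJ' : FiniteDimensional ℂ (t.restrict I').Coinvariants ∧ Module.finrank ℂ (t.restrict I').Coinvariants = 2 ∧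
      ∃ ℓ : Submodule ℂ (t.restrict I').Coinvariants, Module.finrank ℂ ↥ℓ = 1 ∧
        (∀ (m : ↥t.M), ∀ x ∈ ℓ, I'.normalizedJacquet t m x = ((χ m : ℂˣ) : ℂ) • x) ∧
        (∀ (m : ↥t.M) x, I'.normalizedJacquet t m x - ((χ' m : ℂˣ) : ℂ) • x ∈ ℓ))
    (hJH : ∀ c : IrrClass G, c.IsConstituentOf I → ∃ r : SmoothIrrep G, IrrClass.mk r = c ∧ Nontrivial (t.restrict r.ρ).Coinvariants)
    (hred : ∃ N : Subrepresentation I, N ≠ ⊥ ∧ N ≠ ⊤) :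
    ∃ N' : Subrepresentation I', N' ≠ ⊥ ∧ N' ≠ ⊤ := by
  obtain ⟨hfd, hX2⟩ := hJ
  obtain ⟨hfd', hX2', ℓ', hℓ'1, hℓ'χ, hqχ'⟩ := hJ'
  -- Step 1: a non-zero `B : I' → I` (eigen-line functional on `r I'` + Frobenius)
  obtain ⟨φB, hφB⟩ := exists_intertwiningMap_character_of_line hcomm _ χ χ' hne ℓ' hℓ'1 hℓ'χ hqχ'
  obtain ⟨B, hB⟩ := hFrob φB hφB
  -- Step 2: suppose `I'` has no `G`-stable subspace other than `⊥`, `⊤`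
  by_contra hirr
  push Not at hirr
  -- `B` is injective
  have hker : B.ker = ⊥ := by
    by_contra hk
    have htop : B.ker = ⊤ := hirr _ hk
    apply hB
    refine Representation.IntertwiningMap.ext (LinearMap.ext fun x => ?_)
    have hx : x ∈ B.ker := by rw [htop]; trivial
    rw [Representation.IntertwiningMap.mem_ker] at hx
    simpa using hx
  have hinj : Function.Injective B := by
    have h' : LinearMap.ker B.toLinearMap = ⊥ := by
      have := congrArg Subrepresentation.toSubmodule hker
      rw [Representation.IntertwiningMap.ker_toSubmodule] at this
      exact this
    exact LinearMap.ker_eq_bot.mp h'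
  -- Step 3: `range B = ⊤`; otherwise strict monotonicity of `r` in `I` contradicts `range B ≅ I'`
  haveI := hfd
  haveI := hfd'
  have hrange : B.range = ⊤ := by
    by_contra hne'
    have hlt : B.range < ⊤ := lt_top_iff_ne_top.mpr hne'
    have hlt' := Representation.finrank_map_coinvariantsMk_lt_of_lt t hN hsm hJH hlt
    have htop' : Module.finrank ℂ ↥((⊤ : Subrepresentation I).toSubmodule.map (Representation.Coinvariants.mk (t.restrict I))) ≤ 2 :=
      hX2 ▸ Submodule.finrank_le _
    have heq : Module.finrank ℂ ↥(B.range.toSubmodule.map (Representation.Coinvariants.mk (t.restrict I))) = 2 := by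
      rw [← Representation.finrank_coinvariants_toRepresentation_eq t hN hsm B.range]
      let eV : V' ≃ₗ[ℂ] ↥B.range.toSubmodule := LinearEquiv.ofInjective B.toLinearMap hinj
      have heV : ∀ x, ((eV x : ↥B.range.toSubmodule) : V) = B x := fun x => rfl
      have e : I'.Equiv B.range.toRepresentation :=
        Representation.Equiv.mk eV fun g => by
          refine LinearMap.ext fun x => Subtype.ext ?_
          simp only [LinearMap.coe_comp, Function.comp_apply, LinearEquiv.coe_coe,
            Subrepresentation.toRepresentation_apply_coe, heV]
          exact _root_.Representation.IntertwiningMap.isIntertwining I' I B g x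
      haveI hfdR : FiniteDimensional ℂ (t.restrict B.range.toRepresentation).Coinvariants :=
        Module.Finite.of_injective (Representation.jacquetMap t e.symm.toIntertwiningMap).toLinearMap
          (IrrClass.jacquetMap_equiv_injective t e.symm)
      apply le_antisymm
      · calc Module.finrank ℂ (t.restrict B.range.toRepresentation).Coinvariants
            ≤ Module.finrank ℂ (t.restrict I').Coinvariants :=
              LinearMap.finrank_le_finrank_of_injective
                (f := (Representation.jacquetMap t e.symm.toIntertwiningMap).toLinearMap) (IrrClass.jacquetMap_equiv_injective t e.symm)
          _ = 2 := hX2'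
      · calc 2 = Module.finrank ℂ (t.restrict I').Coinvariants := hX2'.symm
          _ ≤ Module.finrank ℂ (t.restrict B.range.toRepresentation).Coinvariants :=
              LinearMap.finrank_le_finrank_of_injective
                (f := (Representation.jacquetMap t e.toIntertwiningMap).toLinearMap) (IrrClass.jacquetMap_equiv_injective t e)
    omega
  have hsurj : Function.Surjective B := by
    intro y
    have hy : y ∈ B.range := by rw [hrange]; trivial
    rw [Representation.IntertwiningMap.mem_range] at hy
    exact hy
  -- Step 4: pull `N` back along the isomorphism `B`
  obtain ⟨N, hNb, hNt⟩ := hred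
  let N' : Subrepresentation I' :=
    { toSubmodule := N.toSubmodule.comap B.toLinearMap
      apply_mem_toSubmodule := fun g x hx => by
        change B (I' g x) ∈ N.toSubmodule
        rw [_root_.Representation.IntertwiningMap.isIntertwining I' I B g x]
        exact N.apply_mem_toSubmodule g hx }
  have hN'b : N' ≠ ⊥ := by
    intro hb
    apply hNb
    refine le_bot_iff.1 fun y hy => ?_
    obtain ⟨x, rfl⟩ := hsurj y
    have hx : x ∈ N' := hy
    rw [hb] at hx
    have hx0 : x = 0 := hx
    rw [hx0, map_zero]
    exact (⊥ : Subrepresentation I).toSubmodule.zero_mem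
  have hN't : N' ≠ ⊤ := by
    intro ht
    apply hNt
    refine top_le_iff.1 fun y _ => ?_
    obtain ⟨x, rfl⟩ := hsurj y
    have hx : x ∈ N' := by rw [ht]; trivial
    exact hx
  exact hN't (hirr N' hN'b)

end Abstract

/-! ## §2 The CM instance: `i_G(χ₁, χ₂)` reducible ⇒ `i_G(χ̄₁⁻¹, χ₂)` reducible (and conversely), `χ` regular -/

section CM

variable (L : Type) [Field L] [NumberField L] [IsCMField L] (v : HeightOneSpectrum (𝓞 ↥(maximalRealSubfield L)))

set_option synthInstance.maxHeartbeats 400000 in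
set_option maxHeartbeats 8000000 in
-- statement∕proof-heavy: the `SmoothInd` carrier of `cmPrincipalSeries`, two Jacquet filtrations (same budget as ★ `cmPrincipalSeries_reducible_of_forall_comp_eq_zero`)
/-- **`i_G(χ)` REDUCIBLE ⇒ `i_G(wχ)` REDUCIBLE** (`G = U(Φ₃)(L⁺_v)`, `v` non-split, `χ = (χ₁, χ₂)` continuous and regular, `wχ = (χ̄₁⁻¹, χ₂)` spelled ★
`cmTorusCharPair L v (conjInvChar σ χ₁) χ₂`).  §1 at `I = i_G(χ)`, `I' = i_G(wχ)`, fed with ★ N1 (hypothesis-free) at both characters (`w² = 1`, ★ `conjInvChar_conjInvChar`),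
★ Frobenius `exists_intertwiningMap_cmPrincipalSeries_ne_zero`, ★ `torusU_mul_comm`, ★ `isLimitOfCompactOpen_cmBorelTriple_N`, and ★ N6 («no constituent of `i_G(χ)` has zero
Jacquet module», `u3_isSupercuspidal_iff_jacquet_eq_zero_holds` through ★ `not_subsingleton_coinvariants_of_isConstituentOf_cmPrincipalSeries`).
[cite: BernsteinZelevinsky1977, Thm. 2.9] [cite: Rogawski1990, §12.2 p. 173] [cite: Keys1984, §7 p. 126] -/
theorem cmPrincipalSeries_weylConj_reducible_of_reducible
    (hns : ∀ w : PlacesOver L v, IsCMField.complexConj L • w.1 = w.1)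
    (χ₁ : (LocalRing L v)ˣ →* ℂˣ) (χ₂ : ↥(normOneUnits (conjLocal L (IsCMField.complexConj L) v)) →* ℂˣ)
    (h₁ : Continuous fun x => ((χ₁ x : ℂˣ) : ℂ)) (h₂ : Continuous fun x => ((χ₂ x : ℂˣ) : ℂ))
    (hreg : cmTorusCharPair L v χ₁ χ₂ ≠ cmTorusCharPair L v (conjInvChar (conjLocal L (IsCMField.complexConj L) v) χ₁) χ₂)
    (hred : ∃ N : Subrepresentation (cmPrincipalSeries L 3 v (cmTorusCharPair L v χ₁ χ₂)), N ≠ ⊥ ∧ N ≠ ⊤) :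
    ∃ N' : Subrepresentation (cmPrincipalSeries L 3 v (cmTorusCharPair L v (conjInvChar (conjLocal L (IsCMField.complexConj L) v) χ₁) χ₂)),
      N' ≠ ⊥ ∧ N' ≠ ⊤ := by
  haveI := locallyCompactSpace_cmBorelU L 3 v
  have hww : cmWeylTorusCharPair L v (conjInvChar (conjLocal L (IsCMField.complexConj L) v) χ₁) χ₂ = cmTorusCharPair L v χ₁ χ₂ := by
    rw [cmWeylTorusCharPair_eq, conjInvChar_conjInvChar _ (conjLocal_conjLocal_cm L v)]
  have h₁' : Continuous fun x => ((conjInvChar (conjLocal L (IsCMField.complexConj L) v) χ₁ x : ℂˣ) : ℂ) :=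
    continuous_coe_conjInvChar _ (continuous_conjLocal L (IsCMField.complexConj L) v) χ₁ h₁
  -- the two Jacquet filtrations (★ N1, hypothesis-free); only the dimension is used at `χ`, the full line data at `wχ`
  obtain ⟨hfd, hX2, -⟩ := (UnitaryGroup.U3PrincipalSeriesJacquetFiltration_iff L).1
    (F0P3U3PrincipalSeriesJacquetFiltrationHolds.U3PrincipalSeriesJacquetFiltration_holds L) v hns χ₁ χ₂ h₁ h₂
  obtain ⟨hfd', hX2', ℓ', hℓ'1, hline', hquot'⟩ := (UnitaryGroup.U3PrincipalSeriesJacquetFiltration_iff L).1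
    (F0P3U3PrincipalSeriesJacquetFiltrationHolds.U3PrincipalSeriesJacquetFiltration_holds L) v hns
    (conjInvChar (conjLocal L (IsCMField.complexConj L) v) χ₁) χ₂ h₁' h₂
  have hline₂ := fun m x hx => (hline' m x hx).trans (by rw [hww])
  exact weyl_reducible_of_reducible (cmBorelTriple L 3 v) (isLimitOfCompactOpen_cmBorelTriple_N L 3 v)
    (UnitaryGroup.torusU_mul_comm _ _) (cmTorusCharPair L v χ₁ χ₂)
    (cmTorusCharPair L v (conjInvChar (conjLocal L (IsCMField.complexConj L) v) χ₁) χ₂) hreg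
    (cmPrincipalSeries L 3 v (cmTorusCharPair L v χ₁ χ₂))
    (cmPrincipalSeries L 3 v (cmTorusCharPair L v (conjInvChar (conjLocal L (IsCMField.complexConj L) v) χ₁) χ₂))
    (isSmooth_cmPrincipalSeries L v _)
    (fun φ hφ => exists_intertwiningMap_cmPrincipalSeries_ne_zero L v _ _ (isSmooth_cmPrincipalSeries L v _) φ hφ)
    ⟨hfd, hX2⟩ ⟨hfd', hX2', ℓ', hℓ'1, hline₂, hquot'⟩
    (fun c hc => by
      obtain ⟨r, rfl⟩ := IrrClass.mk_surjective c
      exact ⟨r, rfl, not_subsingleton_iff_nontrivial.mp fun h0 =>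
        not_subsingleton_coinvariants_of_isConstituentOf_cmPrincipalSeries L v u3_isSupercuspidal_iff_jacquet_eq_zero_holds hns _ r hc h0⟩)
    hred

set_option synthInstance.maxHeartbeats 400000 in
set_option maxHeartbeats 8000000 in
-- statement∕proof-heavy: as above
/-- **Conversely: `i_G(wχ)` REDUCIBLE ⇒ `i_G(χ)` REDUCIBLE** (`χ` regular): the previous theorem at `wχ`, using `w² = 1` (★ `conjInvChar_conjInvChar`) to
rewrite `i_G(w(wχ))` to `i_G(χ)`. [cite: BernsteinZelevinsky1977, Thm. 2.9] [cite: Rogawski1990, §12.2 p. 173] -/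
theorem cmPrincipalSeries_reducible_of_weylConj_reducible
    (hns : ∀ w : PlacesOver L v, IsCMField.complexConj L • w.1 = w.1)
    (χ₁ : (LocalRing L v)ˣ →* ℂˣ) (χ₂ : ↥(normOneUnits (conjLocal L (IsCMField.complexConj L) v)) →* ℂˣ)
    (h₁ : Continuous fun x => ((χ₁ x : ℂˣ) : ℂ)) (h₂ : Continuous fun x => ((χ₂ x : ℂˣ) : ℂ))
    (hreg : cmTorusCharPair L v χ₁ χ₂ ≠ cmTorusCharPair L v (conjInvChar (conjLocal L (IsCMField.complexConj L) v) χ₁) χ₂)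
    (hred' : ∃ N' : Subrepresentation (cmPrincipalSeries L 3 v (cmTorusCharPair L v (conjInvChar (conjLocal L (IsCMField.complexConj L) v) χ₁) χ₂)),
      N' ≠ ⊥ ∧ N' ≠ ⊤) :
    ∃ N : Subrepresentation (cmPrincipalSeries L 3 v (cmTorusCharPair L v χ₁ χ₂)), N ≠ ⊥ ∧ N ≠ ⊤ := by
  have hww : conjInvChar (conjLocal L (IsCMField.complexConj L) v) (conjInvChar (conjLocal L (IsCMField.complexConj L) v) χ₁) = χ₁ :=
    conjInvChar_conjInvChar _ (conjLocal_conjLocal_cm L v) χ₁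
  have h₁' : Continuous fun x => ((conjInvChar (conjLocal L (IsCMField.complexConj L) v) χ₁ x : ℂˣ) : ℂ) :=
    continuous_coe_conjInvChar _ (continuous_conjLocal L (IsCMField.complexConj L) v) χ₁ h₁
  have hreg' : cmTorusCharPair L v (conjInvChar (conjLocal L (IsCMField.complexConj L) v) χ₁) χ₂ ≠
      cmTorusCharPair L v (conjInvChar (conjLocal L (IsCMField.complexConj L) v) (conjInvChar (conjLocal L (IsCMField.complexConj L) v) χ₁)) χ₂ := by
    rw [hww]; exact hreg.symm
  have h := cmPrincipalSeries_weylConj_reducible_of_reducible L v hns (conjInvChar (conjLocal L (IsCMField.complexConj L) v) χ₁) χ₂ h₁' h₂ hreg' hred'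
  rw [hww] at h
  exact h

end CM

end Summit.HodgeConjecture.HodgeConjecture.Cruxes.H413.K2E3PrincipalSeriesWeylReducible

end
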